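import Mathlib
import Summits.Ventures.PercRepro2.MergedUnionPA

/-!
# The two one-sided halves of (UNION-PA) are theorems (blind cell PercRepro2, mine-1 g34)

Row 2′CON-U's open PA statement (UNION-PA) says that `λ̄(· | U)`, `U = {s ↮ X} ∪ {t ↮ Y}`, is
positively associated for the PLAIN clusters `(C_s, V ∖ C_t)`.  This file proves its two
one-sided halves from `merged_union_pa`:

* `cluster_merged_pa`: the pair `(C_s, V ∖ T*)` is positively associated under `P(· | Q ∩ U)` —
  given `T* = merged ω t Y X`, the cluster of `s` is FRESH product percolation on `G ∖ T*` (the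
  `s ↮ X` half of the union is absorbed into `T*`), so the fibration over `T*` is BHK06's proof of
  Theorem 1.5 verbatim with the merged cluster in the role of the explored one;
* `merged_cluster_pa`: symmetrically `(S*, V ∖ C_t)`;
* `cluster_s_pa` / `cluster_t_pa`: the **pure-`s` half** (`Law(C_s | s ↮ t, U)` is positively
  associated) and the **pure-`t` half** (`Law(C_t | s ↮ t, U)` is positively associated) of
  (UNION-PA).  What stays open is the cross term: `f` increasing in `C_s` against `g` decreasing
  in `C_t`.
-/

namespace Summit.Ventures.PercRepro2

namespace MergedU

section Half

variable {V : Type*} {E : Type*} [Fintype E] [DecidableEq E] [Fintype V] [DecidableEq V]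
  {R : Type*} [Field R] [LinearOrder R] [IsStrictOrderedRing R] [Archimedean R]
  {p : E → R} (ends : E → Sym2 V) (s t : V) (X Y : Set V)

omit [Fintype E] [DecidableEq E] [Fintype V] [DecidableEq V] in
/-- On `{s ∉ T*}` the cluster of `s` is its cluster in `G ∖ T*`. -/
lemma cluster_delConfig_merged {ω : Config E} (hs : s ∉ merged ends ω t Y X) :
    cluster ends (delConfig ends (merged ends ω t Y X) ω) s = cluster ends ω s :=
  cluster_delConfig_of_closedOff (fun _ hu => cluster_subset_merged_of_mem hu) hs

omit [DecidableEq V] [LinearOrder R] [IsStrictOrderedRing R] [Archimedean R] in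
/-- **Tower identity, `T*` explored**: `E[Φ(C_s, T*) 1_{s ∉ T*}] = E[Φ̂(T*) 1_{s ∉ T*}]` with
`Φ̂(D) = E_{ω'}[Φ(C_s(delConfig D ω'), D)]`. -/
theorem expect_cluster_merged_mul_indicator (Φ : Set V → Set V → R) :
    expect p (fun ω => Φ (cluster ends ω s) (merged ends ω t Y X) *
        ({ω : Config E | s ∉ merged ends ω t Y X}).indicator 1 ω) =
      expect p (fun ω => expect p (fun ω' =>
        Φ (cluster ends (delConfig ends (merged ends ω t Y X) ω') s) (merged ends ω t Y X)) *
        ({ω : Config E | s ∉ merged ends ω t Y X}).indicator 1 ω) := by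
  classical
  let c : Set V → R := fun D => ({D' : Set V | s ∉ D'}.indicator 1 D)
  let K : Set V → Config E → R := fun D ω => Φ (cluster ends (delConfig ends D ω) s) D
  let Ψ : Set V → Config E → R := fun D ω => c D * K D ω
  have hΨ : ∀ D, DependsOn (Ψ D) (touches ends D)ᶜ := by
    intro D ω ω' h
    simp only [Ψ, K]
    rw [delConfig_congr h]
  have hS : ∀ D : Set V,
      DependsOn (· ∈ {ω : Config E | merged ends ω t Y X = D}) (touches ends D) :=
    fun D => dependsOn_mergedEvent ends t Y X D
  have hdisj : ∀ D : Set V, Disjoint (touches ends D) (touches ends D)ᶜ :=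
    fun D => disjoint_compl_right
  have hpt : ∀ ω, Φ (cluster ends ω s) (merged ends ω t Y X) *
      ({ω : Config E | s ∉ merged ends ω t Y X}).indicator (1 : Config E → R) ω =
      Ψ (merged ends ω t Y X) ω := by
    intro ω
    simp only [Ψ, c, K]
    by_cases hst : s ∈ merged ends ω t Y X
    · rw [Set.indicator_of_notMem (show ω ∉ {ω : Config E | s ∉ merged ends ω t Y X} from
          fun h => h hst),
        Set.indicator_of_notMem (show merged ends ω t Y X ∉ {D' : Set V | s ∉ D'} from
          fun h => h hst)]
      simp
    · rw [Set.indicator_of_mem (show ω ∈ {ω : Config E | s ∉ merged ends ω t Y X} from hst),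
        Set.indicator_of_mem (show merged ends ω t Y X ∈ {D' : Set V | s ∉ D'} from hst),
        cluster_delConfig_merged ends s t X Y hst]
      simp
  have hΨexp : ∀ D, expect p (Ψ D) =
      c D * expect p (fun ω' => Φ (cluster ends (delConfig ends D ω') s) D) := by
    intro D
    simp only [Ψ, K]
    rw [expect_const_mul]
  have e1 : (fun ω => Φ (cluster ends ω s) (merged ends ω t Y X) *
      ({ω : Config E | s ∉ merged ends ω t Y X}).indicator (1 : Config E → R) ω) =
      fun ω => Ψ (merged ends ω t Y X) ω :=
    funext hpt
  rw [e1, expect_tower p hdisj (S := fun ω => merged ends ω t Y X) hS hΨ]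
  simp only [hΨexp]
  unfold expect
  refine Finset.sum_congr rfl fun ω _ => ?_
  simp only [c]
  by_cases hst : s ∈ merged ends ω t Y X
  · rw [Set.indicator_of_notMem (show merged ends ω t Y X ∉ {D' : Set V | s ∉ D'} from
        fun h => h hst),
      Set.indicator_of_notMem (show ω ∉ {ω : Config E | s ∉ merged ends ω t Y X} from
        fun h => h hst)]
    simp
  · rw [Set.indicator_of_mem (show merged ends ω t Y X ∈ {D' : Set V | s ∉ D'} from hst),
      Set.indicator_of_mem (show ω ∈ {ω : Config E | s ∉ merged ends ω t Y X} from hst)]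
    simp

omit [DecidableEq V] in
/-- **`(C_s, V ∖ T*)` is positively associated under the union conditioning**: for `F, G`
increasing in the cluster of `s` and decreasing in the merged cluster `T*` of `t`, `0 ≤ F, G ≤ M`,
`t ∉ Y`, `p e < 1` at `t`:
`E[F(C_s,T*) 1_Q] · E[G(C_s,T*) 1_Q] ≤ E[(F G)(C_s,T*) 1_Q] · P(Q)`, `Q = {s ∉ T*} = {s ↮ t} ∩ U`. -/
theorem cluster_merged_pa (hp : IsProbVec p) (htY : t ∉ Y)
    (hpt : ∀ e ∈ touches ends {t}, p e < 1) {F G : Set V → Set V → R}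
    (hF : ∀ ⦃W W' D D' : Set V⦄, W ⊆ W' → D' ⊆ D → F W D ≤ F W' D')
    (hG : ∀ ⦃W W' D D' : Set V⦄, W ⊆ W' → D' ⊆ D → G W D ≤ G W' D')
    (hF0 : ∀ W D, 0 ≤ F W D) (hG0 : ∀ W D, 0 ≤ G W D) {M : R} (hFM : ∀ W D, F W D ≤ M)
    (hGM : ∀ W D, G W D ≤ M) :
    expect p (fun ω => F (cluster ends ω s) (merged ends ω t Y X) *
        ({ω : Config E | s ∉ merged ends ω t Y X}).indicator 1 ω) *
      expect p (fun ω => G (cluster ends ω s) (merged ends ω t Y X) *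
        ({ω : Config E | s ∉ merged ends ω t Y X}).indicator 1 ω) ≤
    expect p (fun ω => F (cluster ends ω s) (merged ends ω t Y X) *
        G (cluster ends ω s) (merged ends ω t Y X) *
        ({ω : Config E | s ∉ merged ends ω t Y X}).indicator 1 ω) *
      prob p {ω : Config E | s ∉ merged ends ω t Y X} := by
  set Fh : Set V → R := fun D => expect p (fun ω' => F (cluster ends (delConfig ends D ω') s) D)
    with hFh
  set Gh : Set V → R := fun D => expect p (fun ω' => G (cluster ends (delConfig ends D ω') s) D)
    with hGh
  -- `F̂, Ĝ` are antitone in `D`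
  have hFa : ∀ ⦃D D' : Set V⦄, D ⊆ D' → Fh D' ≤ Fh D := fun D D' h =>
    expect_mono hp fun ω' => hF (cluster_mono (ends := ends) (delConfig_anti h ω') s) h
  have hGa : ∀ ⦃D D' : Set V⦄, D ⊆ D' → Gh D' ≤ Gh D := fun D D' h =>
    expect_mono hp fun ω' => hG (cluster_mono (ends := ends) (delConfig_anti h ω') s) h
  have hF0' : ∀ D, 0 ≤ Fh D := fun D => expect_nonneg hp fun _ => hF0 _ _
  have hG0' : ∀ D, 0 ≤ Gh D := fun D => expect_nonneg hp fun _ => hG0 _ _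
  have hFM' : ∀ D, Fh D ≤ M := fun D => expect_le_of_le hp fun _ => hFM _ _
  have hGM' : ∀ D, Gh D ≤ M := fun D => expect_le_of_le hp fun _ => hGM _ _
  -- the merged theorem for functions of `T*` alone
  have key := merged_union_pa ends s t X Y hp htY hpt (F := fun _ D => Fh D)
    (G := fun _ D => Gh D) (fun _ _ _ _ _ h => hFa h) (fun _ _ _ _ _ h => hGa h)
    (fun _ D => hF0' D) (fun _ D => hG0' D) (fun _ D => hFM' D) (fun _ D => hGM' D)
  have hQ : ({ω : Config E | t ∉ merged ends ω s X Y} : Set (Config E)) =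
      {ω : Config E | s ∉ merged ends ω t Y X} := by
    ext ω
    exact notMem_merged_iff ω s t X Y
  rw [hQ] at key
  rw [expect_cluster_merged_mul_indicator ends s t X Y F,
    expect_cluster_merged_mul_indicator ends s t X Y G,
    expect_cluster_merged_mul_indicator ends s t X Y (fun W D => F W D * G W D)]
  -- Harris in the fibre `G ∖ D`
  have hpt' : ∀ ω, Fh (merged ends ω t Y X) * Gh (merged ends ω t Y X) *
      ({ω : Config E | s ∉ merged ends ω t Y X}).indicator (1 : Config E → R) ω ≤
      expect p (fun ω' =>
        F (cluster ends (delConfig ends (merged ends ω t Y X) ω') s) (merged ends ω t Y X) *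
        G (cluster ends (delConfig ends (merged ends ω t Y X) ω') s) (merged ends ω t Y X)) *
        ({ω : Config E | s ∉ merged ends ω t Y X}).indicator 1 ω := by
    intro ω
    refine mul_le_mul_of_nonneg_right ?_ (Set.indicator_apply_nonneg fun _ => zero_le_one)
    apply expect_mul_expect_le_expect_mul hp
    · intro ω₁ ω₂ h
      exact hF (cluster_mono (ends := ends) (delConfig_mono_config _ h) s) (subset_refl _)
    · intro ω₁ ω₂ h
      exact hG (cluster_mono (ends := ends) (delConfig_mono_config _ h) s) (subset_refl _)
  have hmono := expect_mono hp hpt'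
  have hQ0 : 0 ≤ prob p {ω : Config E | s ∉ merged ends ω t Y X} := prob_nonneg hp _
  exact key.trans (mul_le_mul_of_nonneg_right hmono hQ0)

omit [DecidableEq V] in
/-- **The pure-`s` half of (UNION-PA)**: `Law(C_s | s ↮ t, {s ↮ X} ∪ {t ↮ Y})` is positively
associated — for increasing `F, G : 2^V → [0, M]`,
`E[F(C_s) 1_Q] · E[G(C_s) 1_Q] ≤ E[(F G)(C_s) 1_Q] · P(Q)`. -/
theorem cluster_s_pa (hp : IsProbVec p) (htY : t ∉ Y) (hpt : ∀ e ∈ touches ends {t}, p e < 1)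
    {F G : Set V → R} (hF : Monotone F) (hG : Monotone G) (hF0 : ∀ W, 0 ≤ F W)
    (hG0 : ∀ W, 0 ≤ G W) {M : R} (hFM : ∀ W, F W ≤ M) (hGM : ∀ W, G W ≤ M) :
    expect p (fun ω => F (cluster ends ω s) *
        ({ω : Config E | s ∉ merged ends ω t Y X}).indicator 1 ω) *
      expect p (fun ω => G (cluster ends ω s) *
        ({ω : Config E | s ∉ merged ends ω t Y X}).indicator 1 ω) ≤
    expect p (fun ω => F (cluster ends ω s) * G (cluster ends ω s) *
        ({ω : Config E | s ∉ merged ends ω t Y X}).indicator 1 ω) *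
      prob p {ω : Config E | s ∉ merged ends ω t Y X} :=
  cluster_merged_pa ends s t X Y hp htY hpt (F := fun W _ => F W) (G := fun W _ => G W)
    (fun _ _ _ _ h _ => hF h) (fun _ _ _ _ h _ => hG h) (fun W _ => hF0 W) (fun W _ => hG0 W)
    (fun W _ => hFM W) (fun W _ => hGM W)

omit [DecidableEq V] in
/-- **`(S*, V ∖ C_t)` is positively associated under the union conditioning** (the mirror of
`cluster_merged_pa`): for `F, G` increasing in the merged cluster `S*` of `s` and decreasing in
the cluster of `t`. -/
theorem merged_cluster_pa (hp : IsProbVec p) (htY : t ∉ Y)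
    (hpt : ∀ e ∈ touches ends {t}, p e < 1) {F G : Set V → Set V → R}
    (hF : ∀ ⦃W W' D D' : Set V⦄, W ⊆ W' → D' ⊆ D → F W D ≤ F W' D')
    (hG : ∀ ⦃W W' D D' : Set V⦄, W ⊆ W' → D' ⊆ D → G W D ≤ G W' D')
    (hF0 : ∀ W D, 0 ≤ F W D) (hG0 : ∀ W D, 0 ≤ G W D) {M : R} (hFM : ∀ W D, F W D ≤ M)
    (hGM : ∀ W D, G W D ≤ M) :
    expect p (fun ω => F (merged ends ω s X Y) (cluster ends ω t) *
        ({ω : Config E | t ∉ merged ends ω s X Y}).indicator 1 ω) *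
      expect p (fun ω => G (merged ends ω s X Y) (cluster ends ω t) *
        ({ω : Config E | t ∉ merged ends ω s X Y}).indicator 1 ω) ≤
    expect p (fun ω => F (merged ends ω s X Y) (cluster ends ω t) *
        G (merged ends ω s X Y) (cluster ends ω t) *
        ({ω : Config E | t ∉ merged ends ω s X Y}).indicator 1 ω) *
      prob p {ω : Config E | t ∉ merged ends ω s X Y} := by
  -- the tower identity with `S*` explored and the plain cluster of `t` fresh: the `(t, Y, X)`
  -- instance of `expect_cluster_merged_mul_indicator`
  have tower : ∀ Φ : Set V → Set V → R,
      expect p (fun ω => Φ (merged ends ω s X Y) (cluster ends ω t) *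
        ({ω : Config E | t ∉ merged ends ω s X Y}).indicator 1 ω) =
      expect p (fun ω => expect p (fun ω' =>
        Φ (merged ends ω s X Y) (cluster ends (delConfig ends (merged ends ω s X Y) ω') t)) *
        ({ω : Config E | t ∉ merged ends ω s X Y}).indicator 1 ω) := by
    intro Φ
    exact expect_cluster_merged_mul_indicator ends t s Y X (fun D W => Φ W D)
  set Fh : Set V → R := fun W => expect p (fun ω' => F W (cluster ends (delConfig ends W ω') t))
    with hFh
  set Gh : Set V → R := fun W => expect p (fun ω' => G W (cluster ends (delConfig ends W ω') t))
    with hGh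
  have hFm : Monotone Fh := fun W W' h =>
    expect_mono hp fun ω' => hF h (cluster_mono (ends := ends) (delConfig_anti h ω') t)
  have hGm : Monotone Gh := fun W W' h =>
    expect_mono hp fun ω' => hG h (cluster_mono (ends := ends) (delConfig_anti h ω') t)
  have hF0' : ∀ W, 0 ≤ Fh W := fun W => expect_nonneg hp fun _ => hF0 _ _
  have hG0' : ∀ W, 0 ≤ Gh W := fun W => expect_nonneg hp fun _ => hG0 _ _
  have hFM' : ∀ W, Fh W ≤ M := fun W => expect_le_of_le hp fun _ => hFM _ _
  have hGM' : ∀ W, Gh W ≤ M := fun W => expect_le_of_le hp fun _ => hGM _ _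
  have hδ : 0 < prob p (allClosed (tEdges ends t)) := by
    rw [prob_allClosed_tEdges]
    apply Finset.prod_pos
    intro e he
    have := hpt e ((mem_tEdges ends t).1 he)
    linarith
  have key := merged_marginal_pa ends s t X Y hp htY hδ hFm hGm hF0' hG0' hFM' hGM'
  rw [tower F, tower G, tower (fun W D => F W D * G W D)]
  have hpt' : ∀ ω, Fh (merged ends ω s X Y) * Gh (merged ends ω s X Y) *
      ({ω : Config E | t ∉ merged ends ω s X Y}).indicator (1 : Config E → R) ω ≤
      expect p (fun ω' =>
        F (merged ends ω s X Y) (cluster ends (delConfig ends (merged ends ω s X Y) ω') t) *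
        G (merged ends ω s X Y) (cluster ends (delConfig ends (merged ends ω s X Y) ω') t)) *
        ({ω : Config E | t ∉ merged ends ω s X Y}).indicator 1 ω := by
    intro ω
    refine mul_le_mul_of_nonneg_right ?_ (Set.indicator_apply_nonneg fun _ => zero_le_one)
    apply expect_mul_expect_le_expect_mul_anti hp
    · intro ω₁ ω₂ h
      exact hF (subset_refl _) (cluster_mono (ends := ends) (delConfig_mono_config _ h) t)
    · intro ω₁ ω₂ h
      exact hG (subset_refl _) (cluster_mono (ends := ends) (delConfig_mono_config _ h) t)
  have hmono := expect_mono hp hpt'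
  have hQ0 : 0 ≤ prob p {ω : Config E | t ∉ merged ends ω s X Y} := prob_nonneg hp _
  exact key.trans (mul_le_mul_of_nonneg_right hmono hQ0)

omit [DecidableEq V] in
/-- **The pure-`t` half of (UNION-PA)**: `Law(C_t | s ↮ t, {s ↮ X} ∪ {t ↮ Y})` is positively
associated — for decreasing `F, G : 2^V → [0, M]` (equivalently increasing ones),
`E[F(C_t) 1_Q] · E[G(C_t) 1_Q] ≤ E[(F G)(C_t) 1_Q] · P(Q)`. -/
theorem cluster_t_pa (hp : IsProbVec p) (htY : t ∉ Y) (hpt : ∀ e ∈ touches ends {t}, p e < 1)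
    {F G : Set V → R} (hF : Antitone F) (hG : Antitone G) (hF0 : ∀ D, 0 ≤ F D)
    (hG0 : ∀ D, 0 ≤ G D) {M : R} (hFM : ∀ D, F D ≤ M) (hGM : ∀ D, G D ≤ M) :
    expect p (fun ω => F (cluster ends ω t) *
        ({ω : Config E | t ∉ merged ends ω s X Y}).indicator 1 ω) *
      expect p (fun ω => G (cluster ends ω t) *
        ({ω : Config E | t ∉ merged ends ω s X Y}).indicator 1 ω) ≤
    expect p (fun ω => F (cluster ends ω t) * G (cluster ends ω t) *
        ({ω : Config E | t ∉ merged ends ω s X Y}).indicator 1 ω) *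
      prob p {ω : Config E | t ∉ merged ends ω s X Y} :=
  merged_cluster_pa ends s t X Y hp htY hpt (F := fun _ D => F D) (G := fun _ D => G D)
    (fun _ _ _ _ _ h => hF h) (fun _ _ _ _ _ h => hG h) (fun _ D => hF0 D) (fun _ D => hG0 D)
    (fun _ D => hFM D) (fun _ D => hGM D)

end Half

end MergedU

end Summit.Ventures.PercRepro2
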